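import Literature.MathematicalPhysics.QuantumFieldTheory.Balaban1983to89.Beta.GaussianIntegral
import Literature.MathematicalPhysics.QuantumFieldTheory.Balaban1983to89.Beta.KKTBridge
import Literature.MathematicalPhysics.QuantumFieldTheory.Balaban1983to89.B12Beta
import Literature.MathematicalPhysics.QuantumFieldTheory.Balaban1983to89.Beta.DyadicShell

/-!
# `BalabanUV.Beta.FP.ConstraintNormalisation` — road «FP» for binder row D1, organisation γ, row **GAMMA-7** (MODEL, S):
# THE CONSTRAINT-MEASURE NORMALISATION `N_n` — ZERO IN THE LIE-ALGEBRA NORMALISATION; A V-LOCAL (ULTRA-LOCAL) COARSE KERNEL HAS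
# AN EXPLICITLY BOUNDED SECOND MOMENT

HONEST DEPENDENCY (page 1, mandatory): continuum YM on T⁴ ⇐ BetaPertH ∧ nine spine estimates (0/9 proved); BetaPertH ⇐ (D1) ∧
(D4) ∧ CAP+tail; G-an2-4 gates asym, D1 and NE2/3/4.  HONEST FRAMING (cell contract, verbatim): «discharging `BetaPertH` makes
Bałaban's UV stability UNCONDITIONAL — a real constructive-QFT result; it is NOT the continuum limit and NOT the Clay problem.»
THIS MODULE DISCHARGES NOTHING of the wall: it is [folklore] bookkeeping over the tree's kernel discharge of the constrained-Gaussian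
identity C-beta-6 (`Beta.GaussianIntegral`, `Beta.KKTBridge`, consumed BY NAME) and a finite-sum bound in the `B12Beta.secondMoment`
currency.  No `def`, no `def … : Prop`, nothing cited as a fact, 0 sorry; 0 estimates of the manuscripts; 0∕4 row-D1 binders; NOT D1,
NOT BetaPertH, NOT continuum, NOT Clay.

ABSOLUTE RULE (cell charter, verbatim): «No internally-minted statement may enter as a cited fact. Every hypothesis is either
kernel-proved in this package or a verbatim quotation of a PUBLISHED theorem with page reference. The manuscript(s) under audit are NOT
citable for their own disputed steps — they are the thing under adjudication; programme-internal (2001/route/tribunal) claims are never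
citable.»

WHY (owner memo `HOME/b2b-balaban-beta-d1-p3/GAMMA-DESIGN.md` §1, §6 (v), §7 row GAMMA-7; orientation only, nothing of it asserted).
In organisation γ the one shot is written `log Z_n(V) = −½·log|det 𝕂(B)| + N_n(V) + Gh_n(V)`, `𝕂(B) = kkt(H_cov(B), Q_B)`, with `N_n`
«the constraint-measure normalisation (ultra-local in `Q_B`; O(1) second moment)».  Two cases, both MODEL statements here:
* §1 LIE-ALGEBRA NORMALISATION.  When the δ of the block constraint is the product Lebesgue δ of the target (B5 (1.11), the reading
  of record D-pv16.2 of the tree's `ConstrainedGaussian.regZ`), the constrained Gaussian IS `(2π)^{(n−m)/2}·|det kkt(Δ_B, Q_B)|^{−1/2}`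
  (C-beta-6, kernel theorems `GaussianIntegral`'s `ConstrainedGaussian.tendsto_regZ` ∕ `exp_logZ` and `KKTBridge.kkt_det_ne_zero`,
  quoted BY NAME), i.e. along ANY background family `F` the normalisation term `N(B) := log Z(B) + ½·log|det kkt(F B)|` is the
  CONSTANT `((n−m)/2)·log 2π` — the background dependence of the elimination Jacobian (G-beta-1) lives INSIDE `det 𝕂`, because `𝕂`
  keeps `Q_B`.  Hence `δ²N = 0`: `hessianAt_normalisation_eq_zero`, and the one-loop polarization of `OneLoop` is the Hessian of
  `B ↦ −½·log|det kkt(F B)|` ALONE, unconditionally: `polarization_eq_hessianAt_negHalfLogAbsDetKKT` (also for the torus kernels).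
* §2 V-LOCAL NORMALISATIONS.  If instead the δ carries a background-dependent local weight (Haar-type normalisation: a sum over
  coarse bonds of a fixed function of the single bond variable), its Hessian is a coarse kernel of FINITE RANGE `R` in coarse
  units.  For such a kernel `k : B12Beta.Kernel 4` (`R < ‖v‖∞ ⇒ k μ ν v = 0`) with `|k μ ν v| ≤ C` the moment series is a finite sum,
  `HasSum (v ↦ k μ ν v·v_μ·v_ν) (Σ_{‖v‖∞ ≤ R} …)` and `|secondMoment k μ ν| ≤ C·R²·(2R+1)⁴` (`abs_secondMoment_le_of_range`); range
  `0` (bond-diagonal) gives second moment `0`.  This is exactly the shape of the `hD : HasSum (D·v_μ·v_ν) ρ`, `|ρ| ≤ …` slot of the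
  consumer `FP/HorizontalTailAssemblyDefect.abs_secondMoment_sub_window_le_defect` for the piece (v) of GAMMA-DESIGN §6.
The «one-line road instance» (WHICH δ the literal of record carries, hence §1 or §2 with displayed `(R, C)`) is the owner's GAMMA-8.
Provenance: D1 formalisation swarm, unit b2b-balaban-beta-d1-formalise-leaf-04 gen 6 (prover-b2b-balaban-beta-d1-formalise-leaf-04-g6-0),
2026-08-21; row GAMMA-7 of `LEAVES-FP.md` («any seat», statement-first).  [folklore], 0 def, 0 cite, 0 sorry.
-/

noncomputable section

namespace Summit.QuantumFields.BalabanUV.Beta.FP.ConstraintNormalisation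

open Filter Finset
open scoped Topology Matrix BigOperators
open Literature.MathematicalPhysics.QuantumFieldTheory.Balaban1983to89
open Literature.MathematicalPhysics.QuantumFieldTheory.Balaban1983to89.Beta
open Literature.MathematicalPhysics.QuantumFieldTheory.Balaban1983to89.Beta.DyadicShell (Pt supNorm mem_box_iff not_mem_box_iff
  natAbs_le_supNorm supNorm_eq_zero_iff)
open Literature.Probability.LatticeModels (box card_box)

/-! ## §1 The Lie-algebra normalisation: `log Z + ½·log|det kkt|` is a constant, so its Hessian vanishes -/

section LieAlgebra

variable {n m : ℕ}

/-- [folklore] **THE NORMALISATION TERM IS A CONSTANT**: for pv25's constrained Gaussian datum `Z = (Q, Δ)`,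
`log Z + ½·log|det [[Δ,Qᵀ],[Q,0]]| = ((n − m)/2)·log 2π` (definitional over `ConstrainedGaussian.logZ`). -/
theorem logZ_add_half_logAbsDet (Z : ConstrainedGaussian n m) :
    Z.logZ + (1 / 2 : ℝ) * Real.log |Z.kkt.det| = ((n : ℝ) - m) / 2 * Real.log (2 * Real.pi) := by
  unfold ConstrainedGaussian.logZ
  ring

/-- [folklore] The same, solved for `log Z`: `log Z = −½·log|det kkt| + ((n − m)/2)·log 2π`. -/
theorem logZ_eq_negHalfLogAbsDet_add (Z : ConstrainedGaussian n m) :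
    Z.logZ = -(1 / 2 : ℝ) * Real.log |Z.kkt.det| + ((n : ℝ) - m) / 2 * Real.log (2 * Real.pi) := by
  unfold ConstrainedGaussian.logZ
  ring

/-- [folklore] **WHAT `log Z` IS (C-beta-6 by name, the Lie-algebra δ of B5 (1.11))**: under `Regular` the regularised constrained
Gaussian integrals `Z_ε = ∫ δ_ε(Qv) e^{−½vᵀΔv} dv` (heat-kernel δ_ε of the TARGET `ℝ^m`) satisfy
`log Z_ε + ½·log|det kkt| → ((n − m)/2)·log 2π` as `ε ↓ 0`: the normalisation of the ACTUAL integral, read against the bordered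
determinant, is the background-free constant.  (`GaussianIntegral`'s `ConstrainedGaussian.tendsto_log_regZ` + `logZ_add_half_logAbsDet`.) -/
theorem tendsto_log_regZ_add_half_logAbsDet (Z : ConstrainedGaussian n m) (hZ : Z.Regular) :
    Tendsto (fun ε => Real.log (Z.regZ ε) + (1 / 2 : ℝ) * Real.log |Z.kkt.det|) (𝓝[>] 0)
      (𝓝 (((n : ℝ) - m) / 2 * Real.log (2 * Real.pi))) := by
  rw [← logZ_add_half_logAbsDet Z]
  exact (Z.tendsto_log_regZ hZ).add_const _

/-- [folklore] Product form: under `Regular`, `Z_ε · |det kkt|^{1/2} → (2π)^{(n−m)/2}` as `ε ↓ 0`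
(`GaussianIntegral`'s `tendsto_regZ` ∕ `exp_logZ`, `KKTBridge.kkt_det_ne_zero`). -/
theorem tendsto_regZ_mul_sqrt_absDet (Z : ConstrainedGaussian n m) (hZ : Z.Regular) :
    Tendsto (fun ε => Z.regZ ε * |Z.kkt.det| ^ (1 / 2 : ℝ)) (𝓝[>] 0)
      (𝓝 ((2 * Real.pi) ^ (((n : ℝ) - m) / 2))) := by
  have hK : 0 < |Z.kkt.det| := abs_pos.2 (KKTBridge.kkt_det_ne_zero Z hZ)
  have h := (Z.tendsto_regZ hZ).mul_const (|Z.kkt.det| ^ (1 / 2 : ℝ))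
  rw [Z.exp_logZ hZ, mul_assoc, ← Real.rpow_add hK] at h
  norm_num at h
  exact h

variable {ι : Type*}

/-- [folklore] **ALONG ANY BACKGROUND FAMILY THE NORMALISATION TERM IS CONSTANT**: `B ↦ log Z(F B) + ½·log|det kkt(F B)|` is the
constant function `((n − m)/2)·log 2π` — whatever the background dependence of `Q_B` and `Δ_B`. -/
theorem family_normalisation_eq_const (F : Family ι n m) :
    (fun B => F.logZ B + (1 / 2 : ℝ) * Real.log |(F B).kkt.det|) = fun _ => ((n : ℝ) - m) / 2 * Real.log (2 * Real.pi) := by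
  funext B
  exact logZ_add_half_logAbsDet (F B)

/-- [folklore] `log Z` along a family = `−½·log|det kkt|` along the family, plus the constant. -/
theorem family_logZ_eq (F : Family ι n m) :
    F.logZ = fun B => -(1 / 2 : ℝ) * Real.log |(F B).kkt.det| + ((n : ℝ) - m) / 2 * Real.log (2 * Real.pi) := by
  funext B
  exact logZ_eq_negHalfLogAbsDet_add (F B)

/-- [folklore] Adding a constant does not change an iterated Fréchet derivative of positive order (no differentiability needed:
`fderiv (f + c) = fderiv f` pointwise; public twin of `KKTBridge`'s private helper). -/
theorem iteratedFDeriv_succ_add_const_eq {E : Type*} [NormedAddCommGroup E] [NormedSpace ℝ E]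
    (f : E → ℝ) (c : ℝ) (k : ℕ) (x : E) :
    iteratedFDeriv ℝ (k + 1) (fun y => f y + c) x = iteratedFDeriv ℝ (k + 1) f x := by
  rw [iteratedFDeriv_succ_eq_comp_right, iteratedFDeriv_succ_eq_comp_right]
  simp only [Function.comp_apply, fderiv_add_const]

/-- [folklore] `hessianAt (f + c) = hessianAt f` (no differentiability hypothesis). -/
theorem hessianAt_add_const [Fintype ι] [DecidableEq ι] (f : (ι → ℝ) → ℝ) (c : ℝ) (i j : ι) :
    hessianAt (fun B => f B + c) i j = hessianAt f i j := by
  unfold hessianAt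
  rw [iteratedFDeriv_succ_add_const_eq f c 1 0]

/-- [folklore] The Hessian of a constant function vanishes. -/
theorem hessianAt_const [Fintype ι] [DecidableEq ι] (c : ℝ) (i j : ι) : hessianAt (fun _ : ι → ℝ => c) i j = 0 := by
  unfold hessianAt
  rw [iteratedFDeriv_const_of_ne (by norm_num : (2 : ℕ) ≠ 0)]
  rfl

/-- [folklore] **`δ²N_n = 0` IN THE LIE-ALGEBRA NORMALISATION**: along any background family the Hessian (at `B = 0`, in
`OneLoop.hessianAt`'s sense) of the normalisation term `B ↦ log Z(F B) + ½·log|det kkt(F B)|` is ZERO — no differentiability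
hypothesis, no `Regular` hypothesis (it is the Hessian of a constant). -/
theorem hessianAt_normalisation_eq_zero [Fintype ι] [DecidableEq ι] (F : Family ι n m) (i j : ι) :
    hessianAt (fun B => F.logZ B + (1 / 2 : ℝ) * Real.log |(F B).kkt.det|) i j = 0 := by
  rw [family_normalisation_eq_const F, hessianAt_const]

/-- [folklore] **THE ONE-LOOP POLARIZATION IS THE HESSIAN OF `−½·log|det 𝕂|` ALONE**: for every background family `F`,
`polarization F i j = hessianAt (B ↦ −½·log|det kkt(F B)|) i j` UNCONDITIONALLY (the constant `((n − m)/2)·log 2π` drops out of every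
second derivative) — GAMMA-DESIGN §1's `−½log|det 𝕂(B)|` with NO normalisation term, for the Lie-algebra δ. -/
theorem polarization_eq_hessianAt_negHalfLogAbsDetKKT [Fintype ι] [DecidableEq ι] (F : Family ι n m) (i j : ι) :
    polarization F i j = hessianAt (fun B => -(1 / 2 : ℝ) * Real.log |(F B).kkt.det|) i j := by
  rw [polarization_eq_hessianAt, family_logZ_eq F, hessianAt_add_const]

/-- [folklore] The same for the torus kernels of `OneLoop` Part 3: `torusKernel F a₀ μ ν x` is the `((x,μ),a₀), ((0,ν),a₀)` Hessian
entry of `B ↦ −½·log|det kkt(F B)|`. -/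
theorem torusKernel_eq_hessianAt_negHalfLogAbsDetKKT {d s c : ℕ} [NeZero s] (F : Family (ExtIndex d s c) n m) (a₀ : Fin c)
    (μ ν : Fin d) (x : Site d s) :
    torusKernel F a₀ μ ν x = hessianAt (fun B => -(1 / 2 : ℝ) * Real.log |(F B).kkt.det|) ((x, μ), a₀) ((0, ν), a₀) := by
  unfold torusKernel
  rw [polarization_eq_hessianAt_negHalfLogAbsDetKKT]

end LieAlgebra

/-! ## §2 V-local (finite-range) coarse kernels have an explicitly bounded second moment -/

section VLocal

variable {k : B12Beta.Kernel 4} {μ ν : Fin 4} {R : ℕ} {C : ℝ}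

/-- [folklore] On the box `‖v‖∞ ≤ R` every coordinate is at most `R` in absolute value. -/
theorem abs_coord_le_of_mem_box {v : Pt} (hv : v ∈ box 4 R) (i : Fin 4) : |(v i : ℝ)| ≤ R := by
  have h1 : (v i).natAbs ≤ R := (natAbs_le_supNorm v i).trans (mem_box_iff.1 hv)
  have h2 : ((v i).natAbs : ℝ) = |(v i : ℝ)| := by
    rw [Nat.cast_natAbs, Int.cast_abs]
  rw [← h2]
  exact_mod_cast h1

/-- [folklore] **FINITE RANGE ⇒ THE MOMENT SERIES IS A FINITE SUM**: if `k μ ν v = 0` for `‖v‖∞ > R` then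
`HasSum (v ↦ k μ ν v·v_μ·v_ν) (Σ_{‖v‖∞ ≤ R} k μ ν v·v_μ·v_ν)` — the `hD` slot of `HorizontalTailAssemblyDefect.abs_secondMoment_sub_window_le_defect`. -/
theorem hasSum_secondMoment_of_range (hR : ∀ v : Pt, R < supNorm v → k μ ν v = 0) :
    HasSum (fun v : Pt => k μ ν v * (v μ : ℝ) * (v ν : ℝ)) (∑ v ∈ box 4 R, k μ ν v * (v μ : ℝ) * (v ν : ℝ)) := by
  refine hasSum_sum_of_ne_finset_zero fun v hv => ?_
  rw [hR v (not_mem_box_iff.1 hv), zero_mul, zero_mul]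

/-- [folklore] The moment series of a finite-range kernel is summable. -/
theorem summable_secondMoment_of_range (hR : ∀ v : Pt, R < supNorm v → k μ ν v = 0) :
    Summable (fun v : Pt => k μ ν v * (v μ : ℝ) * (v ν : ℝ)) :=
  (hasSum_secondMoment_of_range hR).summable

/-- [folklore] **THE SECOND MOMENT OF A FINITE-RANGE KERNEL IS THE BOX SUM**: `secondMoment k μ ν = Σ_{‖v‖∞ ≤ R} k μ ν v·v_μ·v_ν`. -/
theorem secondMoment_eq_sum_box_of_range (hR : ∀ v : Pt, R < supNorm v → k μ ν v = 0) :
    B12Beta.secondMoment k μ ν = ∑ v ∈ box 4 R, k μ ν v * (v μ : ℝ) * (v ν : ℝ) :=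
  (hasSum_secondMoment_of_range hR).tsum_eq

/-- [folklore] Termwise bound on the box: `|k μ ν v| ≤ C` and `‖v‖∞ ≤ R` give `|k μ ν v·v_μ·v_ν| ≤ C·R²`. -/
theorem abs_term_le_of_mem_box (hC : ∀ v : Pt, |k μ ν v| ≤ C) {v : Pt} (hv : v ∈ box 4 R) :
    |k μ ν v * (v μ : ℝ) * (v ν : ℝ)| ≤ C * (R : ℝ) ^ 2 := by
  have h0 : 0 ≤ C := (abs_nonneg _).trans (hC 0)
  rw [abs_mul, abs_mul, sq, ← mul_assoc]
  exact mul_le_mul (mul_le_mul (hC v) (abs_coord_le_of_mem_box hv μ) (abs_nonneg _) h0)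
    (abs_coord_le_of_mem_box hv ν) (abs_nonneg _) (mul_nonneg h0 (Nat.cast_nonneg R))

/-- [folklore] **V-LOCAL ⇒ O(1) SECOND MOMENT, EXPLICITLY**: a coarse kernel of range `R` (`‖v‖∞ > R ⇒ k μ ν v = 0`) bounded by `C`
has `|secondMoment k μ ν| ≤ C·R²·(2R+1)⁴` (box cardinality `(2R+1)⁴`, `LatticeModels.card_box`).  Both `R` and `C` are displayed:
on the road they are coarse-unit quantities independent of the blocking `n`, which is the «O(1), n-uniform» of GAMMA-DESIGN §6 (v). -/
theorem abs_secondMoment_le_of_range (hR : ∀ v : Pt, R < supNorm v → k μ ν v = 0) (hC : ∀ v : Pt, |k μ ν v| ≤ C) :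
    |B12Beta.secondMoment k μ ν| ≤ C * (R : ℝ) ^ 2 * (2 * (R : ℝ) + 1) ^ 4 := by
  rw [secondMoment_eq_sum_box_of_range hR]
  refine (Finset.abs_sum_le_sum_abs _ _).trans ?_
  refine (Finset.sum_le_sum fun v hv => abs_term_le_of_mem_box hC hv).trans ?_
  rw [Finset.sum_const, nsmul_eq_mul, card_box]
  push_cast
  ring_nf
  rfl

/-- [folklore] The same bound for the `HasSum` value (the `|ρ| ≤ …` companion of `hasSum_secondMoment_of_range`). -/
theorem abs_sum_box_le_of_range (hC : ∀ v : Pt, |k μ ν v| ≤ C) :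
    |∑ v ∈ box 4 R, k μ ν v * (v μ : ℝ) * (v ν : ℝ)| ≤ C * (R : ℝ) ^ 2 * (2 * (R : ℝ) + 1) ^ 4 := by
  refine (Finset.abs_sum_le_sum_abs _ _).trans ?_
  refine (Finset.sum_le_sum fun v hv => abs_term_le_of_mem_box hC hv).trans ?_
  rw [Finset.sum_const, nsmul_eq_mul, card_box]
  push_cast
  ring_nf
  rfl

/-- [folklore] **RANGE ZERO (BOND-DIAGONAL) ⇒ SECOND MOMENT ZERO**: a kernel supported at `v = 0` has `secondMoment k μ ν = 0`
(the only term carries the factor `v_μ = 0`). -/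
theorem secondMoment_eq_zero_of_range_zero (h0 : ∀ v : Pt, v ≠ 0 → k μ ν v = 0) : B12Beta.secondMoment k μ ν = 0 := by
  have hR : ∀ v : Pt, 0 < supNorm v → k μ ν v = 0 := fun v hv =>
    h0 v fun hz => by rw [supNorm_eq_zero_iff.2 hz] at hv; exact lt_irrefl 0 hv
  rw [secondMoment_eq_sum_box_of_range (R := 0) hR]
  refine Finset.sum_eq_zero fun v hv => ?_
  have hz : v = 0 := supNorm_eq_zero_iff.1 (Nat.le_zero.1 (mem_box_iff.1 hv))
  simp [hz]

/-- [folklore] The `HasSum` form of the range-zero case (the consumer's `hD` slot with `ρ = 0`). -/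
theorem hasSum_secondMoment_zero_of_range_zero (h0 : ∀ v : Pt, v ≠ 0 → k μ ν v = 0) :
    HasSum (fun v : Pt => k μ ν v * (v μ : ℝ) * (v ν : ℝ)) 0 := by
  have hR : ∀ v : Pt, 0 < supNorm v → k μ ν v = 0 := fun v hv =>
    h0 v fun hz => by rw [supNorm_eq_zero_iff.2 hz] at hv; exact lt_irrefl 0 hv
  have h := hasSum_secondMoment_of_range (R := 0) hR
  rwa [← secondMoment_eq_sum_box_of_range hR, secondMoment_eq_zero_of_range_zero h0] at h

end VLocal

end Summit.QuantumFields.BalabanUV.Beta.FP.ConstraintNormalisation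

end
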